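import Summits.QuantumFields.YangMills.Theorems.CoarseStiffnessTailCappedCoarseStiffnessLCornerCombBound
import Summits.QuantumFields.YangMills.Theorems.CoarseStiffnessTailCappedCoarseStiffnessLSpectatorPeeling
import Summits.QuantumFields.YangMills.Theorems.CoarseStiffnessTailCappedCoarseStiffnessLCornerCycles
import Summits.QuantumFields.YangMills.Theorems.CoarseStiffnessTailCappedCoarseStiffnessLCycleDefect

/-!
# Route `CoarseStiffnessTail` — THE EXACT-EXPONENT UPPER BOUND: `Z_P(β) ≤ linkMass(β/2)^{(d−1)(|T|−1)} · J_d(β/(2N n² #pairs))`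
# (lead's certificate, seat `ym-line-cst-p1` g15; helper on 25301 `CappedCoarseStiffnessL`, stub S3 = uniform mean action, P2/(R4))

THE THEOREM (`partitionFn_le_cornerComb_mul_cycleIntegral`, `G = SU(N)`, every `Params`, `β ≥ 0`):

  `Z_P(β) ≤ linkMass(β/2)^{(d−1)(|T|−1)} · ∫_{G^d} exp(−s·Σ_{k<l}(1 − Re tr[g_k, g_l])) dHaar^{⊗d}(g)`,   `s = β/(2·N·n²·#{k<l})`,

`n = 2L^{m+K}` the sites per direction.  The first factor carries `(N²−1)/2·(d−1)(|T|−1)` powers of `β^{−1}` (one-plaquette Laplace bound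
of the tree); the second is the FINITE-DIMENSIONAL commuting-tuple integral `J_d(s)`: for `d = 3`, `SU(2)` it decays like `s^{−2}` — two more
Gaussian units — which is exactly the gap between the corner-comb count `3|T| − 3` and the true Laplace exponent `3|T| − 1` of the torus.

PROOF.  `e^{−βA} = e^{−(β/2)A}·e^{−(β/2)A} ≤ [Π_{p∈𝔉} φ_{β/2}(U(∂p))]·exp(−s·D(h(U)))` with `𝔉` the corner-comb family (`boltzmann_le_prod`)
and `D(h) = Σ_{k<l}(1 − Re tr[h_k,h_l])` the commutator defect of the corner CYCLES, `s·D ≤ (β/2)·A` by `…LCycleDefect.cycleDefect_le_action`.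
The cycles consist of FREE bonds of `𝔉` (`…LCornerCombBound.image_pivot_eq`), so the second factor is a spectator for the peeling
(`…LSpectatorPeeling`): `∫ ≤ linkMass(β/2)^{#𝔉}·∫ exp(−s D(h(U))) dU`, and the corner cycles are jointly Haar (`…LCornerCycles`).

HONEST SCOPE.  Assembly of landed pieces; the decay of `J_d` (the `ε⁴` law of almost-commuting `SU(2)` triples) is NOT proved here.  Nothing of
Bałaban's is asserted; the crux 25301, its stubs S1/S2/S3, `HistoryTailL` 19936 stay OPEN; `YM3TorusSU2` (R3, RECORD rung, not Clay) is NOT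
proved; the Yang–Mills mass gap is NOT touched.

References: I. Montvay, G. Münster, *Quantum Fields on a Lattice* (1994) §3.2.5 [MontvayMunster1994]; T. Bałaban, CMP **102** (1985) 255–275
[Balaban1985UV3] ((1)–(3) p.256, (11) p.258).
-/

noncomputable section

open MeasureTheory
open scoped ENNReal BigOperators

namespace Summit.QuantumFields.YangMills.Theorems.CoarseStiffnessTailSharpUpperBound

open Literature.MathematicalPhysics.QuantumFieldTheory.Balaban1983to89 Literature.MathematicalPhysics.QuantumFieldTheory.Balaban1983to89.Missing
open Summit.QuantumFields.BalabanUV.T4Continuum.NE7b.BarePartitionFnDecay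
  (plaqFactor plaqFactor_pos linkMass linkMassE linkMass_nonneg linkMassE_eq_ofReal linkMassE_ne_top linkMassE_le_one
    measurable_plaqFactor boltzmann_le_prod)
open Summit.QuantumFields.YangMills.BalabanUVNodes.N13WilsonPartitionFnAxialTreeUpperBound (measurable_prodPlaqFactor)
open Summit.QuantumFields.YangMills.Theorems.CoarseStiffnessTailCornerCombFamily (pivot_is_link pivot_injOn rank_lt_of_pivot_mem)
open Summit.QuantumFields.YangMills.Theorems.CoarseStiffnessTailCornerCombBound (image_pivot_eq card_cornerComb)
open Summit.QuantumFields.YangMills.Theorems.CoarseStiffnessTailSpectatorPeeling (lintegral_prodPlaqFactor_mul_le_of_peelable)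
open Summit.QuantumFields.YangMills.Theorems.CoarseStiffnessTailCornerCycles (lintegral_cornerCycles_eq measurable_listProd_range)
open Summit.QuantumFields.YangMills.Theorems.CoarseStiffnessTailCycleDefect (cycleDefect_le_action)

variable (N : ℕ) [NeZero N] (P : Params)

/-! ## §1 The cycle bonds are free bonds of the corner-comb family -/

section Free

/-- A corner-cycle bond `⟨c* + i e_k, e_k⟩` is NOT a pivot of the corner-comb family (`image_pivot_eq`: pivots are the bonds `⟨x, δ⟩` with
`x ≠ c*` and `δ ≠ k(x)`; on the cycle either `x = c*` or `k(x) = k = δ`). [folklore] -/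
theorem cycleBond_ne_pivot [DecidableEq (PBond P 0)] {p : Plaq P 0}
    (hp : (∀ i, i < p.μ → p.src i = -1) ∧ (p.src p.μ ≠ -1 ∨ ((∀ i, i < p.ν → p.src i = -1) ∧ p.src p.ν ≠ -1)))
    (k : Fin P.d) (i : ℕ) :
    (if p.src p.μ = -1 then (⟨p.src, p.μ⟩ : PBond P 0) else ⟨p.src, p.ν⟩) ≠
      ⟨Function.update (fun _ => (-1 : ZMod (P.sitesPerDir 0))) k ((-1 : ZMod (P.sitesPerDir 0)) + (i : ZMod (P.sitesPerDir 0))), k⟩ := by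
  classical
  intro h
  have hmem : (if p.src p.μ = -1 then (⟨p.src, p.μ⟩ : PBond P 0) else ⟨p.src, p.ν⟩) ∈
      (Finset.univ.filter fun p : Plaq P 0 =>
        (∀ i, i < p.μ → p.src i = -1) ∧ (p.src p.μ ≠ -1 ∨ ((∀ i, i < p.ν → p.src i = -1) ∧ p.src p.ν ≠ -1))).image
      (fun p : Plaq P 0 => if p.src p.μ = -1 then (⟨p.src, p.μ⟩ : PBond P 0) else ⟨p.src, p.ν⟩) :=
    Finset.mem_image_of_mem _ (Finset.mem_filter.2 ⟨Finset.mem_univ _, hp⟩)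
  rw [image_pivot_eq P, h, Finset.mem_filter] at hmem
  obtain ⟨_, hsrc, hnot⟩ := hmem
  apply hnot
  refine ⟨fun m hm => ?_, ?_⟩
  · show Function.update (fun _ => (-1 : ZMod (P.sitesPerDir 0))) k _ m = -1
    rw [Function.update_of_ne (Fin.ne_of_lt hm)]
  · show Function.update (fun _ => (-1 : ZMod (P.sitesPerDir 0))) k _ k ≠ -1
    rw [Function.update_self]
    intro hc
    apply hsrc
    funext m
    show Function.update (fun _ => (-1 : ZMod (P.sitesPerDir 0))) k _ m = -1
    by_cases hmk : m = k
    · subst hmk; rw [Function.update_self]; exact hc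
    · rw [Function.update_of_ne hmk]

variable {G : Type*} [GaugeGroup G]

/-- Hence the corner cycles do not change when a pivot variable is updated. [folklore] -/
theorem cycle_update_pivot [DecidableEq (PBond P 0)] (U : GaugeField P 0 G) (V : G) {p : Plaq P 0}
    (hp : (∀ i, i < p.μ → p.src i = -1) ∧ (p.src p.μ ≠ -1 ∨ ((∀ i, i < p.ν → p.src i = -1) ∧ p.src p.ν ≠ -1))) (k : Fin P.d) :
    ((List.range (P.sitesPerDir 0)).map fun i : ℕ =>
        (Function.update U (if p.src p.μ = -1 then (⟨p.src, p.μ⟩ : PBond P 0) else ⟨p.src, p.ν⟩) V)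
          ⟨Function.update (fun _ => (-1 : ZMod (P.sitesPerDir 0))) k ((-1 : ZMod (P.sitesPerDir 0)) + (i : ZMod (P.sitesPerDir 0))), k⟩).prod =
      ((List.range (P.sitesPerDir 0)).map fun i : ℕ =>
        U ⟨Function.update (fun _ => (-1 : ZMod (P.sitesPerDir 0))) k ((-1 : ZMod (P.sitesPerDir 0)) + (i : ZMod (P.sitesPerDir 0))), k⟩).prod := by
  congr 1
  refine List.map_congr_left fun i _ => ?_
  rw [Function.update_of_ne (cycleBond_ne_pivot P hp k i).symm]

end Free

/-! ## §2 The spectator and the pointwise domination -/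

section Spectator

/-- Measurability of the cycle-defect spectator on `G^d`: `g ↦ ofReal(exp(−s·Σ_{k<l}(1 − Re tr[g_k,g_l])))`. [folklore] -/
theorem measurable_defectWeight {G : Type*} [GaugeGroup G] [MeasurableSpace G] [RegularGaugeGroup G] (s : ℝ) :
    Measurable fun g : Fin P.d → G => ENNReal.ofReal (Real.exp (-s *
      ∑ kl ∈ (Finset.univ.filter fun kl : Fin P.d × Fin P.d => kl.1 < kl.2), (1 - reTr (g kl.1 * g kl.2 * (g kl.1)⁻¹ * (g kl.2)⁻¹)))) := by
  refine ((Measurable.const_mul ?_ (-s)).exp).ennreal_ofReal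
  refine Finset.measurable_sum _ fun kl _ => measurable_const.sub (RegularGaugeGroup.measurable_reTr.comp ?_)
  exact (((measurable_pi_apply kl.1).mul (measurable_pi_apply kl.2)).mul (measurable_pi_apply kl.1).inv).mul
    (measurable_pi_apply kl.2).inv

/-- Measurability of the corner-cycle map `U ↦ (k ↦ h_k(U))`. [folklore] -/
theorem measurable_cycles {G : Type*} [GaugeGroup G] [MeasurableSpace G] [MeasurableMul₂ G] :
    Measurable fun U : GaugeField P 0 G => fun k : Fin P.d => ((List.range (P.sitesPerDir 0)).map fun i : ℕ =>
      U ⟨Function.update (fun _ => (-1 : ZMod (P.sitesPerDir 0))) k ((-1 : ZMod (P.sitesPerDir 0)) + (i : ZMod (P.sitesPerDir 0))), k⟩).prod :=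
  measurable_pi_lambda _ fun _ => measurable_listProd_range P _ _

/-- **THE POINTWISE DOMINATION** (`G = SU(N)`, `β ≥ 0`): with `s = β/(2N n² #{k<l})`,
`e^{−βA(U)} ≤ [Π_{p∈𝔉} φ_{β/2}(U(∂p))]·exp(−s·Σ_{k<l}(1 − Re tr[h_k(U),h_l(U)]))` over the corner-comb family `𝔉`. [folklore] -/
theorem boltzmann_le_prod_mul_defectWeight {β : ℝ} (hβ : 0 ≤ β) (U : GaugeField P 0 (Matrix.specialUnitaryGroup (Fin N) ℂ)) :
    ENNReal.ofReal (boltzmann P β U) ≤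
      (∏ p ∈ (Finset.univ.filter fun p : Plaq P 0 =>
          (∀ i, i < p.μ → p.src i = -1) ∧ (p.src p.μ ≠ -1 ∨ ((∀ i, i < p.ν → p.src i = -1) ∧ p.src p.ν ≠ -1))),
          ENNReal.ofReal (plaqFactor (β / 2) (GaugeField.plaqHol U p))) *
        ENNReal.ofReal (Real.exp (-(β / (2 * ((N : ℝ) * ((P.sitesPerDir 0 : ℝ) * (P.sitesPerDir 0 : ℝ)) *
            ((Finset.univ.filter fun kl : Fin P.d × Fin P.d => kl.1 < kl.2).card : ℝ)))) *
          ∑ kl ∈ (Finset.univ.filter fun kl : Fin P.d × Fin P.d => kl.1 < kl.2),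
            (1 - reTr (((List.range (P.sitesPerDir 0)).map fun i : ℕ => U ⟨Function.update (fun _ => (-1 : ZMod (P.sitesPerDir 0))) kl.1
                ((-1 : ZMod (P.sitesPerDir 0)) + (i : ZMod (P.sitesPerDir 0))), kl.1⟩).prod *
              ((List.range (P.sitesPerDir 0)).map fun j : ℕ => U ⟨Function.update (fun _ => (-1 : ZMod (P.sitesPerDir 0))) kl.2
                ((-1 : ZMod (P.sitesPerDir 0)) + (j : ZMod (P.sitesPerDir 0))), kl.2⟩).prod *
              (((List.range (P.sitesPerDir 0)).map fun i : ℕ => U ⟨Function.update (fun _ => (-1 : ZMod (P.sitesPerDir 0))) kl.1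
                ((-1 : ZMod (P.sitesPerDir 0)) + (i : ZMod (P.sitesPerDir 0))), kl.1⟩).prod)⁻¹ *
              (((List.range (P.sitesPerDir 0)).map fun j : ℕ => U ⟨Function.update (fun _ => (-1 : ZMod (P.sitesPerDir 0))) kl.2
                ((-1 : ZMod (P.sitesPerDir 0)) + (j : ZMod (P.sitesPerDir 0))), kl.2⟩).prod)⁻¹)))) := by
  have hD := cycleDefect_le_action N P U
  have hC0 : (0 : ℝ) ≤ (N : ℝ) * ((P.sitesPerDir 0 : ℝ) * (P.sitesPerDir 0 : ℝ)) *
      ((Finset.univ.filter fun kl : Fin P.d × Fin P.d => kl.1 < kl.2).card : ℝ) := by positivity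
  have hA0 := wilsonAction4_nonneg U
  -- `s·D ≤ (β/2)·A`
  have hsD : β / (2 * ((N : ℝ) * ((P.sitesPerDir 0 : ℝ) * (P.sitesPerDir 0 : ℝ)) *
      ((Finset.univ.filter fun kl : Fin P.d × Fin P.d => kl.1 < kl.2).card : ℝ))) *
      ∑ kl ∈ (Finset.univ.filter fun kl : Fin P.d × Fin P.d => kl.1 < kl.2),
        (1 - reTr (((List.range (P.sitesPerDir 0)).map fun i : ℕ => U ⟨Function.update (fun _ => (-1 : ZMod (P.sitesPerDir 0))) kl.1
            ((-1 : ZMod (P.sitesPerDir 0)) + (i : ZMod (P.sitesPerDir 0))), kl.1⟩).prod *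
          ((List.range (P.sitesPerDir 0)).map fun j : ℕ => U ⟨Function.update (fun _ => (-1 : ZMod (P.sitesPerDir 0))) kl.2
            ((-1 : ZMod (P.sitesPerDir 0)) + (j : ZMod (P.sitesPerDir 0))), kl.2⟩).prod *
          (((List.range (P.sitesPerDir 0)).map fun i : ℕ => U ⟨Function.update (fun _ => (-1 : ZMod (P.sitesPerDir 0))) kl.1
            ((-1 : ZMod (P.sitesPerDir 0)) + (i : ZMod (P.sitesPerDir 0))), kl.1⟩).prod)⁻¹ *
          (((List.range (P.sitesPerDir 0)).map fun j : ℕ => U ⟨Function.update (fun _ => (-1 : ZMod (P.sitesPerDir 0))) kl.2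
            ((-1 : ZMod (P.sitesPerDir 0)) + (j : ZMod (P.sitesPerDir 0))), kl.2⟩).prod)⁻¹)) ≤ β / 2 * wilsonAction4 U := by
    rcases eq_or_lt_of_le hC0 with hC | hC
    · rw [← hC, mul_zero, div_zero, zero_mul]; positivity
    · rw [div_mul_eq_mul_div, div_le_iff₀ (by positivity)]
      have := mul_le_mul_of_nonneg_left hD hβ
      nlinarith
  have hsplit : boltzmann P β U = boltzmann P (β / 2) U * Real.exp (-(β / 2) * wilsonAction4 U) := by
    simp only [boltzmann, ← Real.exp_add]; congr 1; ring
  have h1 := boltzmann_le_prod P (by positivity : (0 : ℝ) ≤ β / 2)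
    (Finset.univ.filter fun p : Plaq P 0 =>
      (∀ i, i < p.μ → p.src i = -1) ∧ (p.src p.μ ≠ -1 ∨ ((∀ i, i < p.ν → p.src i = -1) ∧ p.src p.ν ≠ -1))) U
  rw [hsplit, ENNReal.ofReal_mul (boltzmann_pos P _ U).le]
  have h1' := ENNReal.ofReal_le_ofReal h1
  rw [ENNReal.ofReal_prod_of_nonneg fun p _ => (plaqFactor_pos _ _).le] at h1'
  refine mul_le_mul' h1' (ENNReal.ofReal_le_ofReal (Real.exp_le_exp.2 ?_))
  rw [neg_mul]
  linarith

end Spectator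

/-! ## §3 The exact-exponent upper bound -/

section Bound

/-- **★★★ THE EXACT-EXPONENT UPPER BOUND ON BAŁABAN's TORUS PARTITION FUNCTION** (`G = SU(N)`, every `Params`, `β ≥ 0`):
`Z_P(β) ≤ linkMass(β/2)^{(d−1)(|T|−1)} · ∫_{G^d} exp(−s·Σ_{k<l}(1 − Re tr(g_k g_l g_k⁻¹ g_l⁻¹))) dHaar^{⊗d}`, `s = β/(2N·n²·#{k<l})`. [folklore] -/
theorem partitionFn_le_cornerComb_mul_cycleIntegral {β : ℝ} (hβ : 0 ≤ β) :
    partitionFn (G := Matrix.specialUnitaryGroup (Fin N) ℂ) P β ≤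
      linkMass (G := Matrix.specialUnitaryGroup (Fin N) ℂ) (β / 2) ^ ((P.d - 1) * (Fintype.card (Site P 0) - 1)) *
        ∫ g, Real.exp (-(β / (2 * ((N : ℝ) * ((P.sitesPerDir 0 : ℝ) * (P.sitesPerDir 0 : ℝ)) *
            ((Finset.univ.filter fun kl : Fin P.d × Fin P.d => kl.1 < kl.2).card : ℝ)))) *
          ∑ kl ∈ (Finset.univ.filter fun kl : Fin P.d × Fin P.d => kl.1 < kl.2),
            (1 - reTr (g kl.1 * g kl.2 * (g kl.1)⁻¹ * (g kl.2)⁻¹)))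
          ∂(Measure.pi fun _ : Fin P.d => (HaarData.haar : Measure (Matrix.specialUnitaryGroup (Fin N) ℂ))) := by
  classical
  haveI : IsProbabilityMeasure (HaarData.haar : Measure (Matrix.specialUnitaryGroup (Fin N) ℂ)) := HaarData.isProb
  haveI := isProbabilityMeasure_fieldMeasure (G := Matrix.specialUnitaryGroup (Fin N) ℂ) P 0
  -- opaque abbreviations
  obtain ⟨s, hs⟩ : ∃ s : ℝ, s = β / (2 * ((N : ℝ) * ((P.sitesPerDir 0 : ℝ) * (P.sitesPerDir 0 : ℝ)) *
      ((Finset.univ.filter fun kl : Fin P.d × Fin P.d => kl.1 < kl.2).card : ℝ))) := ⟨_, rfl⟩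
  obtain ⟨Fw, hFw⟩ : ∃ Fw : (Fin P.d → Matrix.specialUnitaryGroup (Fin N) ℂ) → ℝ≥0∞, Fw = fun g => ENNReal.ofReal (Real.exp (-s *
      ∑ kl ∈ (Finset.univ.filter fun kl : Fin P.d × Fin P.d => kl.1 < kl.2), (1 - reTr (g kl.1 * g kl.2 * (g kl.1)⁻¹ * (g kl.2)⁻¹)))) :=
    ⟨_, rfl⟩
  obtain ⟨cyc, hcyc⟩ : ∃ cyc : GaugeField P 0 (Matrix.specialUnitaryGroup (Fin N) ℂ) → Fin P.d → Matrix.specialUnitaryGroup (Fin N) ℂ,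
      cyc = fun U k => ((List.range (P.sitesPerDir 0)).map fun i : ℕ =>
        U ⟨Function.update (fun _ => (-1 : ZMod (P.sitesPerDir 0))) k ((-1 : ZMod (P.sitesPerDir 0)) + (i : ZMod (P.sitesPerDir 0))), k⟩).prod :=
    ⟨_, rfl⟩
  have hcard := card_cornerComb P
  have hFm : Measurable Fw := by rw [hFw]; exact measurable_defectWeight P (G := Matrix.specialUnitaryGroup (Fin N) ℂ) s
  have hcycm : Measurable cyc := by rw [hcyc]; exact measurable_cycles P (G := Matrix.specialUnitaryGroup (Fin N) ℂ)
  have hGm : Measurable fun U => Fw (cyc U) := hFm.comp hcycm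
  -- (1) pointwise domination, in the opaque letters
  have hpt : ∀ U : GaugeField P 0 (Matrix.specialUnitaryGroup (Fin N) ℂ), ENNReal.ofReal (boltzmann P β U) ≤
      (∏ p ∈ (Finset.univ.filter fun p : Plaq P 0 =>
          (∀ i, i < p.μ → p.src i = -1) ∧ (p.src p.μ ≠ -1 ∨ ((∀ i, i < p.ν → p.src i = -1) ∧ p.src p.ν ≠ -1))),
          ENNReal.ofReal (plaqFactor (β / 2) (GaugeField.plaqHol U p))) * Fw (cyc U) := by
    intro U
    have h := boltzmann_le_prod_mul_defectWeight N P hβ U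
    rw [← hs] at h
    rw [hFw, hcyc]
    exact h
  -- (2) peeling with the spectator `Fw ∘ cyc`
  have hinv : ∀ p ∈ (Finset.univ.filter fun p : Plaq P 0 =>
        (∀ i, i < p.μ → p.src i = -1) ∧ (p.src p.μ ≠ -1 ∨ ((∀ i, i < p.ν → p.src i = -1) ∧ p.src p.ν ≠ -1))),
      ∀ (U : GaugeField P 0 (Matrix.specialUnitaryGroup (Fin N) ℂ)) (V : Matrix.specialUnitaryGroup (Fin N) ℂ),
        Fw (cyc (Function.update U (if p.src p.μ = -1 then (⟨p.src, p.μ⟩ : PBond P 0) else ⟨p.src, p.ν⟩) V)) = Fw (cyc U) := by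
    intro p hp U V
    have hp' := (Finset.mem_filter.1 hp).2
    have hc : cyc (Function.update U (if p.src p.μ = -1 then (⟨p.src, p.μ⟩ : PBond P 0) else ⟨p.src, p.ν⟩) V) = cyc U := by
      rw [hcyc]
      funext k
      exact cycle_update_pivot P U V hp' k
    rw [hc]
  have hpeel := lintegral_prodPlaqFactor_mul_le_of_peelable P (β / 2)
    (Finset.univ.filter fun p : Plaq P 0 =>
      (∀ i, i < p.μ → p.src i = -1) ∧ (p.src p.μ ≠ -1 ∨ ((∀ i, i < p.ν → p.src i = -1) ∧ p.src p.ν ≠ -1)))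
    (fun p : Plaq P 0 => if p.src p.μ = -1 then (⟨p.src, p.μ⟩ : PBond P 0) else ⟨p.src, p.ν⟩)
    (fun p : Plaq P 0 => p.μ.val * ((P.d + 1) * P.sitesPerDir 0) +
      (if p.src p.μ = -1 then p.ν.val * P.sitesPerDir 0 + (p.src p.ν).val else P.d * P.sitesPerDir 0 + (p.src p.μ).val))
    (fun p _ => pivot_is_link P p)
    (fun p hp q hq h => pivot_injOn P (Finset.mem_filter.1 (Finset.mem_coe.1 hp)).2 (Finset.mem_filter.1 (Finset.mem_coe.1 hq)).2 h)
    (fun p hp q hq hne hmem => rank_lt_of_pivot_mem P (Finset.mem_filter.1 hp).2 (Finset.mem_filter.1 hq).2 hne hmem)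
    (fun U => Fw (cyc U)) hGm hinv
  -- (3) the cycles are jointly Haar
  have hcycles : ∫⁻ U, Fw (cyc U) ∂fieldMeasure P 0 (Matrix.specialUnitaryGroup (Fin N) ℂ) =
      ∫⁻ g, Fw g ∂(Measure.pi fun _ : Fin P.d => (HaarData.haar : Measure (Matrix.specialUnitaryGroup (Fin N) ℂ))) := by
    have h := lintegral_cornerCycles_eq P (G := Matrix.specialUnitaryGroup (Fin N) ℂ) Fw hFm
    rw [hcyc]
    exact h
  -- (1)+(2)+(3) in `ℝ≥0∞`
  have hint := integrable_boltzmann (G := Matrix.specialUnitaryGroup (Fin N) ℂ) RegularGaugeGroup.measurable_reTr P hβ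
  have hZ : ENNReal.ofReal (partitionFn (G := Matrix.specialUnitaryGroup (Fin N) ℂ) P β) ≤
      linkMassE (G := Matrix.specialUnitaryGroup (Fin N) ℂ) (β / 2) ^ ((P.d - 1) * (Fintype.card (Site P 0) - 1)) *
        ∫⁻ g, Fw g ∂(Measure.pi fun _ : Fin P.d => (HaarData.haar : Measure (Matrix.specialUnitaryGroup (Fin N) ℂ))) := by
    rw [show partitionFn (G := Matrix.specialUnitaryGroup (Fin N) ℂ) P β =
        ∫ U, boltzmann P β U ∂fieldMeasure P 0 (Matrix.specialUnitaryGroup (Fin N) ℂ) from rfl,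
      ofReal_integral_eq_lintegral_ofReal hint (Filter.Eventually.of_forall fun U => (boltzmann_pos P β U).le), ← hcycles, ← hcard]
    exact (lintegral_mono fun U => hpt U).trans hpeel
  -- (4) back to real numbers
  have hnn : ∀ g : Fin P.d → Matrix.specialUnitaryGroup (Fin N) ℂ, 0 ≤
      ∑ kl ∈ (Finset.univ.filter fun kl : Fin P.d × Fin P.d => kl.1 < kl.2), (1 - reTr (g kl.1 * g kl.2 * (g kl.1)⁻¹ * (g kl.2)⁻¹)) :=
    fun g => Finset.sum_nonneg fun kl _ => sub_nonneg.mpr (GaugeGroup.reTr_le_one _)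
  have hs0 : 0 ≤ s := by rw [hs]; positivity
  have hFw_le : ∀ g, Fw g ≤ 1 := fun g => by
    rw [hFw]; exact ENNReal.ofReal_le_one.2 (Real.exp_le_one_iff.2 (by nlinarith [hnn g]))
  have hJfin : ∫⁻ g, Fw g ∂(Measure.pi fun _ : Fin P.d => (HaarData.haar : Measure (Matrix.specialUnitaryGroup (Fin N) ℂ))) ≠ ∞ := by
    refine ne_top_of_le_ne_top ENNReal.one_ne_top ?_
    calc ∫⁻ g, Fw g ∂(Measure.pi fun _ : Fin P.d => (HaarData.haar : Measure (Matrix.specialUnitaryGroup (Fin N) ℂ)))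
        ≤ ∫⁻ _, 1 ∂(Measure.pi fun _ : Fin P.d => (HaarData.haar : Measure (Matrix.specialUnitaryGroup (Fin N) ℂ))) :=
          lintegral_mono hFw_le
      _ = 1 := by rw [lintegral_one, measure_univ]
  have hmeasR : Measurable fun g : Fin P.d → Matrix.specialUnitaryGroup (Fin N) ℂ => Real.exp (-s *
      ∑ kl ∈ (Finset.univ.filter fun kl : Fin P.d × Fin P.d => kl.1 < kl.2), (1 - reTr (g kl.1 * g kl.2 * (g kl.1)⁻¹ * (g kl.2)⁻¹))) := by
    refine (Measurable.const_mul ?_ (-s)).exp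
    refine Finset.measurable_sum _ fun kl _ => measurable_const.sub (RegularGaugeGroup.measurable_reTr.comp ?_)
    exact (((measurable_pi_apply kl.1).mul (measurable_pi_apply kl.2)).mul (measurable_pi_apply kl.1).inv).mul
      (measurable_pi_apply kl.2).inv
  have hJeq : (∫⁻ g, Fw g ∂(Measure.pi fun _ : Fin P.d => (HaarData.haar : Measure (Matrix.specialUnitaryGroup (Fin N) ℂ)))).toReal =
      ∫ g, Real.exp (-s *
        ∑ kl ∈ (Finset.univ.filter fun kl : Fin P.d × Fin P.d => kl.1 < kl.2), (1 - reTr (g kl.1 * g kl.2 * (g kl.1)⁻¹ * (g kl.2)⁻¹)))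
        ∂(Measure.pi fun _ : Fin P.d => (HaarData.haar : Measure (Matrix.specialUnitaryGroup (Fin N) ℂ))) := by
    rw [integral_eq_lintegral_of_nonneg_ae (Filter.Eventually.of_forall fun g => (Real.exp_pos _).le) hmeasR.aestronglyMeasurable, hFw]
  have hfin : linkMassE (G := Matrix.specialUnitaryGroup (Fin N) ℂ) (β / 2) ^ ((P.d - 1) * (Fintype.card (Site P 0) - 1)) *
      ∫⁻ g, Fw g ∂(Measure.pi fun _ : Fin P.d => (HaarData.haar : Measure (Matrix.specialUnitaryGroup (Fin N) ℂ))) ≠ ∞ :=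
    ENNReal.mul_ne_top (ENNReal.pow_ne_top (linkMassE_ne_top _)) hJfin
  have hreal := (ENNReal.ofReal_le_iff_le_toReal hfin).1 hZ
  rw [ENNReal.toReal_mul, ENNReal.toReal_pow, linkMassE_eq_ofReal, ENNReal.toReal_ofReal (linkMass_nonneg _), hJeq, hs] at hreal
  exact hreal

end Bound

end Summit.QuantumFields.YangMills.Theorems.CoarseStiffnessTailSharpUpperBound

end
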